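import Literature.Probability.RandomPlanarGeometry.HalfPlaneFill
import HarnessLib

/-!
# Disjoint fills of disjoint one-sided anchored sets — helper stub `stub_rangeIsArc_disjointFills`
(line `marked-point-revisit` of crux `SAWLoopFugacityFlow.SimpleSubseqLimits`,
stmt-CriticalPhenomena-4982; plan `RangeIsArc-PLAN.md`, M2 "disjointness package")

Let `T₊, T₋ ⊆ ℍ̄` be compact and attached to the lower half-plane (`T ∪ {Im ≤ 0}` connected),
the real points of `T₊` positive and those of `T₋` negative, and `T₊ ∩ T₋ = ∅`. Then the
half-plane fills `hpFill T±` ([LSW] §2 "Fillings", file `HalfPlaneFill`: the closure of the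
complement in `ℍ` of the unbounded component `V_T` of `ℍ ∖ T`) are disjoint, and the real points
of `hpFill T₊` (resp. `hpFill T₋`) are positive (resp. negative).

Proof (pure plane topology; signs are carried by `σ = ±1`).
* (Corner) For `S` compact whose points `z` with `σ Re z ≤ 0` have `Im z > 0`, compactness gives
  `δ > 0` with `δ ≤ max (Im z) (σ Re z)` on `S`; the corner `{0 < Im < δ, σ Re < δ}` is convex,
  unbounded and misses `S`, so it lies in `V_S`; it contains the upper half of `B(x, δ)` for
  every real `x` with `σ x ≤ 0`, whence no such `x` is in `hpFill S` (the sign clauses).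
* (Attached sets stay outside) If `T` is closed, disjoint from `S`, `T ∪ {Im ≤ 0}` is connected
  and the points of `T` off `ℍ` lie in an open `L` with `L ∩ ℍ ⊆ V_S`, then `T ∩ ℍ ⊆ V_S`: the
  open sets `V_S ∪ L ∪ Tᶜ` and "union of the bounded components of `ℍ ∖ S`" would disconnect
  `T ∪ {Im ≤ 0}`.
* (Common lake) A point of `ℍ` in both fills and off `T₊ ∪ T₋` lies in bounded components `U₊`,
  `U₋` of `ℍ ∖ T₊`, `ℍ ∖ T₋`; by the previous step `U₊ ⊆ ℍ ∖ T₋` and `U₋ ⊆ ℍ ∖ T₊`, so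
  `U₊ = U₋ = U`; a frontier point of the bounded open nonempty `U` is off `ℍ` (a component of
  the open `ℍ ∖ T` is relatively closed in it, and `T₊ ∩ T₋ = ∅`), hence a real point of both
  fills, whose signs clash. So `U` would be clopen in `ℂ`.
-/

noncomputable section

open Filter Topology Set Metric Bornology Complex
open Literature.Probability.RandomPlanarGeometry
open UpperHalfPlane (upperHalfPlaneSet isOpen_upperHalfPlaneSet)

namespace Summit.CriticalPhenomena.SAWScalingLimit.Theorems.SimpleSubseqLimits.MarkedPointRevisit.ArcRangeFills

/-! ### Corners in the unbounded component -/

/-- The corner `{0 < Im < δ, σ Re < δ}` (`σ = ±1`, `δ > 0`) is preconnected (convex) and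
unbounded (it contains `-σ x + iδ/2` for all large `x`). [folklore] -/
theorem isPreconnected_corner {σ : ℝ} (hσ : σ = 1 ∨ σ = -1) {δ : ℝ} (hδ : 0 < δ) :
    IsPreconnected {z : ℂ | 0 < z.im ∧ z.im < δ ∧ σ * z.re < δ} ∧
      ¬ IsBounded {z : ℂ | 0 < z.im ∧ z.im < δ ∧ σ * z.re < δ} := by
  constructor
  · have hlin : IsLinearMap ℝ fun z : ℂ ↦ σ * z.re :=
      { map_add := fun a b ↦ by simp [mul_add]
        map_smul := fun c a ↦ by simp [mul_left_comm] }
    have : {z : ℂ | 0 < z.im ∧ z.im < δ ∧ σ * z.re < δ} =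
        {z : ℂ | 0 < z.im} ∩ ({z : ℂ | z.im < δ} ∩ {z : ℂ | σ * z.re < δ}) := by
      ext z; simp
    rw [this]
    exact ((convex_halfSpace_im_gt 0).inter
      ((convex_halfSpace_im_lt δ).inter (convex_halfSpace_lt hlin δ))).isPreconnected
  · intro hb
    obtain ⟨C, hC⟩ := hb.subset_closedBall 0
    have hσ2 : σ * σ = 1 := by rcases hσ with rfl | rfl <;> norm_num
    have hσabs : |σ| = 1 := by rcases hσ with rfl | rfl <;> norm_num
    set q : ℂ := ⟨-σ * (|C| + 1), δ / 2⟩ with hq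
    have hqre : σ * q.re = -(|C| + 1) := by
      simp only [hq]; rw [← mul_assoc, mul_neg, hσ2]; ring
    have hqmem : q ∈ {z : ℂ | 0 < z.im ∧ z.im < δ ∧ σ * z.re < δ} :=
      ⟨show 0 < δ / 2 by positivity, show δ / 2 < δ by linarith,
        by rw [hqre]; linarith [abs_nonneg C]⟩
    have h1 := hC hqmem
    rw [mem_closedBall, dist_zero_right] at h1
    have h2 : |q.re| ≤ ‖q‖ := abs_re_le_norm q
    have h3 : |σ * q.re| = |q.re| := by rw [abs_mul, hσabs, one_mul]
    rw [hqre, abs_neg, abs_of_pos (by positivity)] at h3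
    linarith [le_abs_self C]

/-- **Corner lemma.** For `S` compact whose points `z` with `σ Re z ≤ 0` have `Im z > 0`
(`σ = ±1`), some corner `{0 < Im < δ, σ Re < δ}` with `δ > 0` misses `S`, hence lies in the
unbounded component of `ℍ ∖ S`. [folklore] -/
theorem exists_corner_subset {S : Set ℂ} (hS : IsCompact S) {σ : ℝ} (hσ : σ = 1 ∨ σ = -1)
    (hpos : ∀ z ∈ S, σ * z.re ≤ 0 → 0 < z.im) :
    ∃ δ > 0, {z : ℂ | 0 < z.im ∧ z.im < δ ∧ σ * z.re < δ} ⊆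
      Loewner.unboundedComponent (upperHalfPlaneSet \ S) := by
  -- `δ ≤ max (Im z) (σ Re z)` on `S`, by compactness
  obtain ⟨δ, hδ, hSδ⟩ : ∃ δ > 0, ∀ z ∈ S, z.im < δ → δ ≤ σ * z.re := by
    rcases S.eq_empty_or_nonempty with h | hne
    · exact ⟨1, one_pos, fun z hz _ ↦ by simp [h] at hz⟩
    · obtain ⟨z₀, hz₀, hmin⟩ := hS.exists_isMinOn hne
        (continuous_im.max (continuous_const.mul continuous_re)).continuousOn
      have h0 : 0 < max z₀.im (σ * z₀.re) := by
        by_cases h : σ * z₀.re ≤ 0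
        · exact lt_max_of_lt_left (hpos z₀ hz₀ h)
        · exact lt_max_of_lt_right (not_le.1 h)
      refine ⟨_, h0, fun z hz hzim ↦ ?_⟩
      by_contra hre
      have h1 : max z₀.im (σ * z₀.re) ≤ max z.im (σ * z.re) := hmin hz
      exact absurd h1 (not_le.2 (max_lt hzim (not_le.1 hre)))
  obtain ⟨hconn, hunb⟩ := isPreconnected_corner hσ hδ
  refine ⟨δ, hδ, subset_unboundedComponent_of_isPreconnected hconn ?_ hunb⟩
  rintro z ⟨hz0, hzδ, hzre⟩
  exact ⟨hz0, fun hzS ↦ absurd (hSδ z hzS hzδ) (not_le.2 hzre)⟩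

/-- The upper half of the disc `B(x, δ)` at a real `x` with `σ x ≤ 0` lies in the corner
`{0 < Im < δ, σ Re < δ}`. [folklore] -/
theorem ball_inter_subset_corner {σ : ℝ} (hσ : σ = 1 ∨ σ = -1) {δ x : ℝ} (hx : σ * x ≤ 0) :
    ball (x : ℂ) δ ∩ upperHalfPlaneSet ⊆ {z : ℂ | 0 < z.im ∧ z.im < δ ∧ σ * z.re < δ} := by
  rintro z ⟨hz, hzH⟩
  rw [mem_ball, dist_eq_norm] at hz
  have him := (abs_im_le_norm (z - x)).trans_lt hz
  have hre := (abs_re_le_norm (z - x)).trans_lt hz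
  simp only [sub_im, ofReal_im, sub_zero, sub_re, ofReal_re] at him hre
  refine ⟨hzH, (le_abs_self _).trans_lt him, ?_⟩
  have h4 : σ * (z.re - x) ≤ |z.re - x| := by
    rcases hσ with rfl | rfl
    · rw [one_mul]; exact le_abs_self _
    · rw [neg_one_mul]; exact neg_le_abs _
  have h5 : σ * z.re = σ * x + σ * (z.re - x) := by ring
  linarith

/-- **Sign of the real points of a fill.** If a corner `{0 < Im < δ, σ Re < δ}` lies in the
unbounded component of `ℍ ∖ S`, no real `x` with `σ x ≤ 0` is in `hpFill S = cl (ℍ ∖ V_S)`.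
[folklore] -/
theorem ofReal_notMem_hpFill_of_corner {S : Set ℂ} {σ δ : ℝ} (hσ : σ = 1 ∨ σ = -1) (hδ : 0 < δ)
    (hV : {z : ℂ | 0 < z.im ∧ z.im < δ ∧ σ * z.re < δ} ⊆
      Loewner.unboundedComponent (upperHalfPlaneSet \ S)) {x : ℝ} (hx : σ * x ≤ 0) :
    (x : ℂ) ∉ hpFill S := by
  rw [hpFill, mem_closure_iff_nhds]
  push Not
  exact ⟨ball (x : ℂ) δ, ball_mem_nhds _ hδ, Set.eq_empty_of_forall_notMem
    fun z ⟨hz, hzH, hzV⟩ ↦ hzV (hV (ball_inter_subset_corner hσ hx ⟨hz, hzH⟩))⟩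

/-! ### Attached sets stay in the unbounded component -/

/-- **Attached sets stay outside the bounded components.** Let `S` be closed and bounded, `T`
closed and disjoint from `S` with `T ∪ {Im ≤ 0}` preconnected, and `L` open, containing the
points of `T` off `ℍ`, with `L ∩ ℍ` inside the unbounded component `V` of `ℍ ∖ S`. Then
`T ∩ ℍ ⊆ V`: the open sets `V ∪ L ∪ Tᶜ` and "union of the bounded components of `ℍ ∖ S`" cover
`T ∪ {Im ≤ 0}` without a common point of it. [folklore] -/
theorem inter_subset_unboundedComponent {S T L : Set ℂ} (hS : IsClosed S) (hSb : IsBounded S)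
    (hT : IsClosed T) (hTS : Disjoint T S) (hconn : IsPreconnected (T ∪ {z : ℂ | z.im ≤ 0}))
    (hL : IsOpen L)
    (hLV : L ∩ upperHalfPlaneSet ⊆ Loewner.unboundedComponent (upperHalfPlaneSet \ S))
    (hTL : ∀ z ∈ T, z.im ≤ 0 → z ∈ L) :
    T ∩ upperHalfPlaneSet ⊆ Loewner.unboundedComponent (upperHalfPlaneSet \ S) := by
  set V := Loewner.unboundedComponent (upperHalfPlaneSet \ S) with hV
  -- the union `v` of the bounded components of `ℍ ∖ S` is open
  set v : Set ℂ := {z : ℂ | z ∈ upperHalfPlaneSet \ S ∧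
    IsBounded (connectedComponentIn (upperHalfPlaneSet \ S) z)} with hv
  have hvo : IsOpen v := by
    refine isOpen_iff_forall_mem_open.2 fun z hz ↦
      ⟨connectedComponentIn (upperHalfPlaneSet \ S) z,
        fun w hw ↦ ⟨connectedComponentIn_subset _ _ hw, ?_⟩,
        (isOpen_upperHalfPlaneSet.sdiff hS).connectedComponentIn, mem_connectedComponentIn hz.1⟩
    rw [← connectedComponentIn_eq hw]
    exact hz.2
  set u : Set ℂ := V ∪ L ∪ Tᶜ with hu
  have huo : IsOpen u := ((isOpen_unboundedComponent hS hSb).union hL).union hT.isOpen_compl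
  have hcover : T ∪ {z : ℂ | z.im ≤ 0} ⊆ u ∪ v := by
    intro w _
    by_cases hwT : w ∈ T
    · by_cases hwH : w ∈ upperHalfPlaneSet
      · have hwS : w ∉ S := fun h ↦ Set.disjoint_left.1 hTS hwT h
        by_cases hb : IsBounded (connectedComponentIn (upperHalfPlaneSet \ S) w)
        · exact Or.inr ⟨⟨hwH, hwS⟩, hb⟩
        · exact Or.inl (Or.inl (Or.inl ⟨⟨hwH, hwS⟩, hb⟩))
      · exact Or.inl (Or.inl (Or.inr (hTL w hwT (not_lt.1 hwH))))
    · exact Or.inl (Or.inr hwT)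
  have huv : ∀ w ∈ T ∪ {z : ℂ | z.im ≤ 0}, w ∈ u → w ∉ v := by
    rintro w hw ((hwV | hwL) | hwT) hwv
    · exact hwV.2 hwv.2
    · exact (hLV ⟨hwL, hwv.1.1⟩).2 hwv.2
    · rcases hw with h | h
      · exact hwT h
      · exact absurd (show 0 < w.im from hwv.1.1) (not_lt.2 h)
  rintro z ⟨hzT, hzH⟩
  have hzS : z ∉ S := fun h ↦ Set.disjoint_left.1 hTS hzT h
  by_contra hzV
  have hzv : z ∈ v := ⟨⟨hzH, hzS⟩, by by_contra hb; exact hzV ⟨⟨hzH, hzS⟩, hb⟩⟩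
  have hIu : -I ∈ u := by
    by_cases h : -I ∈ T
    · exact Or.inl (Or.inr (hTL _ h (by simp)))
    · exact Or.inr h
  obtain ⟨w, hw, hwu, hwv⟩ :=
    hconn u v huo hvo hcover ⟨-I, Or.inr (by simp), hIu⟩ ⟨z, Or.inl hzT, hzv⟩
  exact huv w hw hwu hwv

/-! ### Frontier points of bounded components -/

/-- A point of `closure U ∖ U` off `S`, for `U` a component of the open set `ℍ ∖ S`, is off `ℍ`:
the component of such a point of `ℍ ∖ S` would be an open neighbourhood meeting `U`. [folklore] -/
theorem im_eq_zero_of_mem_closure {S : Set ℂ} (hS : IsClosed S) {z₀ w : ℂ}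
    (hw : w ∈ closure (connectedComponentIn (upperHalfPlaneSet \ S) z₀))
    (hwU : w ∉ connectedComponentIn (upperHalfPlaneSet \ S) z₀) (hwS : w ∉ S) : w.im = 0 := by
  have hwim : 0 ≤ w.im := by
    have : closure (connectedComponentIn (upperHalfPlaneSet \ S) z₀) ⊆ closure upperHalfPlaneSet :=
      closure_mono ((connectedComponentIn_subset _ _).trans sdiff_subset)
    have h := this hw
    rw [show upperHalfPlaneSet = {z : ℂ | 0 < z.im} from rfl, closure_setOf_lt_im] at h
    exact h
  refine le_antisymm (not_lt.1 fun hwpos ↦ ?_) hwim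
  obtain ⟨ρ, hρ, hρsub⟩ :=
    Metric.isOpen_iff.1 (isOpen_upperHalfPlaneSet.sdiff hS) w ⟨hwpos, hwS⟩
  rw [Metric.mem_closure_iff] at hw
  obtain ⟨u, huU, hu⟩ := hw ρ hρ
  have h1 := (convex_ball w ρ).isPreconnected.subset_connectedComponentIn (mem_ball'.2 hu) hρsub
  rw [← connectedComponentIn_eq huU] at h1
  exact hwU (h1 (mem_ball_self hρ))

/-! ### The stub -/

/-- **Helper stub M2 of `stub_rangeIsArc_tests` (line `marked-point-revisit`) — disjoint fills.**
For compact `T₊, T₋ ⊆ ℍ̄` attached to the lower half-plane (`T± ∪ {Im ≤ 0}` connected), with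
the real points of `T₊` positive, those of `T₋` negative, and `T₊ ∩ T₋ = ∅`: the fills
`hpFill T₊`, `hpFill T₋` are disjoint, the real points of `hpFill T₊` are positive and those of
`hpFill T₋` negative (module docstring for the proof). [folklore] -/
theorem stub_rangeIsArc_disjointFills :
    ∀ (Tp Tm : Set ℂ), IsCompact Tp → IsCompact Tm → Tp ⊆ closure upperHalfPlaneSet →
      Tm ⊆ closure upperHalfPlaneSet → IsConnected (Tp ∪ {z : ℂ | z.im ≤ 0}) →
      IsConnected (Tm ∪ {z : ℂ | z.im ≤ 0}) → (∀ x : ℝ, (x : ℂ) ∈ Tp → 0 < x) →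
      (∀ x : ℝ, (x : ℂ) ∈ Tm → x < 0) → Disjoint Tp Tm →
      Disjoint (hpFill Tp) (hpFill Tm) ∧ (∀ x : ℝ, (x : ℂ) ∈ hpFill Tp → 0 < x) ∧
        (∀ x : ℝ, (x : ℂ) ∈ hpFill Tm → x < 0) := by
  intro Tp Tm hTp hTm hTpcl hTmcl hcp hcm hpos hneg hdisj
  have hcl : closure upperHalfPlaneSet = {z : ℂ | 0 ≤ z.im} := Complex.closure_setOf_lt_im 0
  have hre_of_im : ∀ {z : ℂ}, z.im = 0 → z = ((z.re : ℝ) : ℂ) := fun h ↦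
    Complex.ext (by simp) (by simp [h])
  -- the points of `T±` off `ℍ` are real points, of the given sign
  have hTpre : ∀ z ∈ Tp, z.im ≤ 0 → 0 < z.re := fun z hz hzim ↦ by
    have h0 : z.im = 0 := le_antisymm hzim (by simpa [hcl] using hTpcl hz)
    exact hpos z.re (by rw [← hre_of_im h0]; exact hz)
  have hTmre : ∀ z ∈ Tm, z.im ≤ 0 → z.re < 0 := fun z hz hzim ↦ by
    have h0 : z.im = 0 := le_antisymm hzim (by simpa [hcl] using hTmcl hz)
    exact hneg z.re (by rw [← hre_of_im h0]; exact hz)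
  have hTpσ : ∀ z ∈ Tp, (1 : ℝ) * z.re ≤ 0 → 0 < z.im := fun z hz hre ↦ by
    by_contra h
    have := hTpre z hz (not_lt.1 h)
    linarith
  have hTmσ : ∀ z ∈ Tm, (-1 : ℝ) * z.re ≤ 0 → 0 < z.im := fun z hz hre ↦ by
    by_contra h
    have := hTmre z hz (not_lt.1 h)
    linarith
  -- corners in the unbounded components, and the sign clauses
  obtain ⟨δp, hδp, hVp⟩ := exists_corner_subset hTp (Or.inl rfl) hTpσ
  obtain ⟨δm, hδm, hVm⟩ := exists_corner_subset hTm (Or.inr rfl) hTmσ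
  have hsignp : ∀ x : ℝ, (x : ℂ) ∈ hpFill Tp → 0 < x := fun x hx ↦ by
    by_contra h
    exact ofReal_notMem_hpFill_of_corner (Or.inl rfl) hδp hVp
      (show (1 : ℝ) * x ≤ 0 by linarith [not_lt.1 h]) hx
  have hsignm : ∀ x : ℝ, (x : ℂ) ∈ hpFill Tm → x < 0 := fun x hx ↦ by
    by_contra h
    exact ofReal_notMem_hpFill_of_corner (Or.inr rfl) hδm hVm
      (show (-1 : ℝ) * x ≤ 0 by linarith [not_lt.1 h]) hx
  refine ⟨?_, hsignp, hsignm⟩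
  -- (α)/(β): inside `ℍ`, each set lies in the unbounded component of the complement of the other
  have hα : Tp ∩ upperHalfPlaneSet ⊆ Loewner.unboundedComponent (upperHalfPlaneSet \ Tm) :=
    inter_subset_unboundedComponent
      (L := {z : ℂ | z.im < δm} ∩ {z : ℂ | (-1 : ℝ) * z.re < δm}) hTm.isClosed hTm.isBounded
      hTp.isClosed hdisj hcp.isPreconnected
      ((isOpen_lt continuous_im continuous_const).inter
        (isOpen_lt (continuous_const.mul continuous_re) continuous_const))
      (fun w hw ↦ hVm ⟨hw.2, hw.1.1, hw.1.2⟩) fun w hw hwim ↦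
        ⟨show w.im < δm by linarith, by
          show (-1 : ℝ) * w.re < δm
          linarith [hTpre w hw hwim]⟩
  have hβ : Tm ∩ upperHalfPlaneSet ⊆ Loewner.unboundedComponent (upperHalfPlaneSet \ Tp) :=
    inter_subset_unboundedComponent
      (L := {z : ℂ | z.im < δp} ∩ {z : ℂ | (1 : ℝ) * z.re < δp}) hTp.isClosed hTp.isBounded
      hTm.isClosed hdisj.symm hcm.isPreconnected
      ((isOpen_lt continuous_im continuous_const).inter
        (isOpen_lt (continuous_const.mul continuous_re) continuous_const))
      (fun w hw ↦ hVp ⟨hw.2, hw.1.1, hw.1.2⟩) fun w hw hwim ↦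
        ⟨show w.im < δp by linarith, by
          show (1 : ℝ) * w.re < δp
          linarith [hTmre w hw hwim]⟩
  rw [Set.disjoint_left]
  intro z hzp hzm
  have hzim : 0 ≤ z.im := by simpa [hcl] using hpFill_subset_closure Tp hzp
  rcases hzim.lt_or_eq with hzpos | hz0
  swap
  · -- `z` real: the signs clash
    have hz : z = ((z.re : ℝ) : ℂ) := hre_of_im hz0.symm
    rw [hz] at hzp hzm
    linarith [hsignp _ hzp, hsignm _ hzm]
  -- `z ∈ ℍ`: off both unbounded components
  have hzp' : z ∈ hpFill Tp ∩ upperHalfPlaneSet := ⟨hzp, hzpos⟩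
  have hzm' : z ∈ hpFill Tm ∩ upperHalfPlaneSet := ⟨hzm, hzpos⟩
  rw [hpFill_inter hTp.isClosed hTp.isBounded] at hzp'
  rw [hpFill_inter hTm.isClosed hTm.isBounded] at hzm'
  by_cases hzTp : z ∈ Tp
  · exact hzm'.2 (hα ⟨hzTp, hzpos⟩)
  by_cases hzTm : z ∈ Tm
  · exact hzp'.2 (hβ ⟨hzTm, hzpos⟩)
  -- (γ): `z` off both sets, in bounded components `Up`, `Um`
  set Up := connectedComponentIn (upperHalfPlaneSet \ Tp) z with hUp
  set Um := connectedComponentIn (upperHalfPlaneSet \ Tm) z with hUm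
  have hUpb : IsBounded Up := by
    by_contra hb
    exact hzp'.2 ⟨⟨hzpos, hzTp⟩, hb⟩
  have hUmb : IsBounded Um := by
    by_contra hb
    exact hzm'.2 ⟨⟨hzpos, hzTm⟩, hb⟩
  have hUpV : Up ⊆ upperHalfPlaneSet \ Loewner.unboundedComponent (upperHalfPlaneSet \ Tp) :=
    fun w hw ↦ ⟨(connectedComponentIn_subset _ _ hw).1, fun hwV ↦ hwV.2 (by
      rw [← connectedComponentIn_eq hw]; exact hUpb)⟩
  have hUmV : Um ⊆ upperHalfPlaneSet \ Loewner.unboundedComponent (upperHalfPlaneSet \ Tm) :=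
    fun w hw ↦ ⟨(connectedComponentIn_subset _ _ hw).1, fun hwV ↦ hwV.2 (by
      rw [← connectedComponentIn_eq hw]; exact hUmb)⟩
  -- `Up ⊆ ℍ ∖ Tm` and `Um ⊆ ℍ ∖ Tp` by (β), (α); hence `Up = Um`
  have hUpTm : Up ⊆ upperHalfPlaneSet \ Tm := fun w hw ↦
    ⟨(hUpV hw).1, fun hwTm ↦ (hUpV hw).2 (hβ ⟨hwTm, (hUpV hw).1⟩)⟩
  have hUmTp : Um ⊆ upperHalfPlaneSet \ Tp := fun w hw ↦
    ⟨(hUmV hw).1, fun hwTp ↦ (hUmV hw).2 (hα ⟨hwTp, (hUmV hw).1⟩)⟩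
  have hUeq : Up = Um := Subset.antisymm
    (isPreconnected_connectedComponentIn.subset_connectedComponentIn
      (mem_connectedComponentIn ⟨hzpos, hzTp⟩) hUpTm)
    (isPreconnected_connectedComponentIn.subset_connectedComponentIn
      (mem_connectedComponentIn ⟨hzpos, hzTm⟩) hUmTp)
  -- the common lake `Up` has empty frontier
  have hUo : IsOpen Up := (isOpen_upperHalfPlaneSet.sdiff hTp.isClosed).connectedComponentIn
  have hfr : frontier Up = ∅ := by
    rw [frontier, hUo.interior_eq]
    refine Set.eq_empty_of_forall_notMem fun w ⟨hwcl, hwU⟩ ↦ ?_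
    have hwim : w.im = 0 := by
      by_cases hwTp : w ∈ Tp
      · have hwTm : w ∉ Tm := fun h ↦ Set.disjoint_left.1 hdisj hwTp h
        rw [hUeq] at hwcl hwU
        exact im_eq_zero_of_mem_closure hTm.isClosed hwcl hwU hwTm
      · exact im_eq_zero_of_mem_closure hTp.isClosed hwcl hwU hwTp
    have hwp : w ∈ hpFill Tp := closure_mono hUpV hwcl
    have hwm : w ∈ hpFill Tm := closure_mono hUmV (hUeq ▸ hwcl)
    rw [hre_of_im hwim] at hwp hwm
    linarith [hsignp _ hwp, hsignm _ hwm]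
  rcases isClopen_iff.1 (isClopen_iff_frontier_eq_empty.2 hfr) with h | h
  · have : z ∈ Up := mem_connectedComponentIn ⟨hzpos, hzTp⟩
    rw [h] at this
    exact this
  · apply NormedSpace.unbounded_univ ℝ ℂ
    rw [← h]
    exact hUpb

end Summit.CriticalPhenomena.SAWScalingLimit.Theorems.SimpleSubseqLimits.MarkedPointRevisit.ArcRangeFills

end
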